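import Literature.AlgebraicGeometry.Motives.HodgeStructureLefschetzGroupCenterPointsCountBlocks
import HarnessLib

/-!
# WHEN DOES THE CENTRE OF `S(A)` NOT GROW UNDER EXTENSION OF SCALARS? `t_K = t` IFF NO BLOCK CENTRE `C₀(S) ⊗ K` SPLITS, I.E. IFF
# EVERY `Z(C(S)(K))` IS A FIELD; `t_K = 1` IFF `Z(C(H)(K))` IS A FIELD; FIRST KIND: `#Z(S(A)(K)) = #Z(S(A)(ℚ)) = 2^t` IFF SO
# (Milne 1999 §1 p. 645 «`C₀(A)` is a product of fields», `S₀(A)(R)`, Prop. 1.7, Remark 1.6; Moonen–Zarhin 1998 §1 Lemma (1))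

[topic AlgebraicGeometry/Motives]

Layer `Literature/AlgebraicGeometry/Motives`, lane `lit-hodgefound` (Track 2 foundations library; prover seat
`lit-hodgefound-p02`, generation 55, self-proposed row g55-#11). THEOREMS ONLY: no definition, no named fact (net debt `0`),
no instance, no notation.  `C₀(A) = Π_S C₀(S)` is a product of fields over the simple factors (Milne p. 645; the canonical
blocks `S`, with `C₀(S) = Z(E_φ(S))` a field since `E_φ(S)` is simple, g55-#3), and after extension of scalars to a field
`K ⊇ ℚ` (Remark 1.6 «`C'(A) ≅ C(A) ⊗_k k'`») each factor `C₀(S) ⊗ K = Z(C(S)(K))` is a reduced commutative finite-dimensional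
`K`-algebra with `t_K(S) ≥ 1` simple factors, `t_K(H) = Σ_S t_K(S)` (g55-#10).  Here:
(i) ALGEBRA: a reduced finite-dimensional commutative `K`-algebra has exactly one maximal ideal iff it is a field (reduced local
Artinian rings are fields); so `t_K(H) = 1` iff `Z(C(H)(K))` is a field, and `t_K(S) = 1` iff `C₀(S) ⊗ K` is a field («does
not split»);
(ii) `t_K(H) = t` (the number of canonical blocks = simple factors of `End⁰`) iff EVERY block centre `Z(C(S)(K))` is a field;
(iii) FIRST KIND: `#Z(S(H)(K)) = 2^t` — equivalently `#Z(S(H)(K)) = #Z(S(H)(ℚ))` (g54-#8 `#Z(S(H)(ℚ)) = 2^t`), i.e. the embedding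
`Z(S(H)(ℚ)) ↪ Z(S(H)(K))` (g54-#10) is onto — iff every block centre `Z(C(S)(K))` is a field;
(iv) `E_φ` SIMPLE (one block), first kind: `#Z(S(H)(K)) = 2` iff `Z(C(H)(K))` is a field (the `K`-form of g55-#3's `#Z(S(H)(ℚ)) = 2`).

## The sources, verbatim

* J. S. Milne, *Lefschetz classes on abelian varieties*, Duke Math. J. 96 (1999) 639–675 [Milne1999LefschetzClasses] (held
  `paper:doi-10-1215-s0012-7094-99-09620-5`): folio 7 = p. 645 L1–L14 «let `C₀(A)` be the centre of the `ℚ`-algebra `End⁰(A)` —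
  it is a product of fields, each of which is either a CM-field or `ℚ` … `S₀(A)(R) = {γ ∈ C₀(A) ⊗_ℚ R | γ†γ = 1}` … Proposition
  1.7 … an isomorphism `C₀(A) ⊗_ℚ ℚ_ℓ → C_ℓ(A)` of `ℚ_ℓ`-algebras with involution, and hence an isomorphism of algebraic groups
  `S₀(A)_{/ℚ_ℓ} → S_ℓ(A)`»; folio 6 = p. 644 Prop. 1.5 and Remark 1.6 «`C'(A) ≅ C(A) ⊗_k k'`, `S'(A) ≅ S(A)_{/k'}`»; §2 Summary
  p. 652.
* B. J. J. Moonen, Yu. G. Zarhin, *Weil classes on abelian varieties*, J. reine angew. Math. 496 (1998) 83–92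
  [MoonenZarhin1998WeilClasses] (held `paper:arxiv-alg-geom_9612017`, chunk p0002 L121–L127): «Lemma. (1) The center of
  `G_div(X)` is the group `U_{K_B}` given by `U_{K_B}(R) = {a ∈ (K_B ⊗_ℚ R)^* ∣ a a† = 1}` … in all other cases it is finite.»
* H. Lange, *Abelian Varieties over the Complex Numbers* (2023) [Lange2023AbelianVarietiesComplex], §2.4.4 Cor. 2.4.26, §2.6.2
  Lemma 2.6.4.

Nearest tree results, BY NAME: g55-#10 `Polarization.natCard_maximalSpectrum_center_centralizer_eq_sum_minimal_stable`,
`one_le_natCard_maximalSpectrum_center_centralizer_of_ne_bot`, `Polarization.natCard_center_lefschetzGroupBaseChange_eq_prod_two_pow`;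
g55-#8 `Polarization.natCard_center_lefschetzGroupBaseChange_eq_two_pow`, `isReduced_center_centralizer_endAlg_baseChange`; g54-#8
`Polarization.natCard_center_lefschetzGroup_eq_two_pow`; g55-#3 `natCard_minimal_stable_eq_one_iff_isSimpleRing_endAlg`; Mathlib
`IsArtinianRing.isField_of_isReduced_of_isLocalRing`, `IsLocalRing.of_unique_max_ideal`.

## Dictionary and what is proved (namespace `Literature.AlgebraicGeometry.Motives.HodgeStructure`)

`Z_K(H) = Subalgebra.center K C(H)(K)`, `t_K(H) = Nat.card (MaximalSpectrum Z_K(H))`, `t = #ψ.finite_setOf_minimal_stable.toFinset`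
(canonical blocks); "first kind" = `∀ z ∈ Z(E_φ), z† = z`.

* §1 **`natCard_maximalSpectrum_center_centralizer_eq_one_iff_isField`** (`t_K(H) = 1` iff `Z_K(H)` is a field, `V ≠ 0`).
* §2 **`Polarization.natCard_maximalSpectrum_center_centralizer_eq_card_iff_forall_isField`** (`t_K(H) = t` iff every
  `Z(C(S)(K))` is a field), **`Polarization.card_toFinset_minimal_stable_lt_natCard_maximalSpectrum_iff`** (`t < t_K` iff some
  block centre splits).
* §3 FIRST KIND: **`Polarization.natCard_center_lefschetzGroupBaseChange_eq_two_pow_card_iff`** (`#Z(S(H)(K)) = 2^t` iff no block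
  centre splits), **`Polarization.natCard_center_lefschetzGroupBaseChange_eq_natCard_center_lefschetzGroup_iff`**
  (`#Z(S(H)(K)) = #Z(S(H)(ℚ))` iff so).
* §4 `E_φ` SIMPLE, first kind: **`Polarization.natCard_center_lefschetzGroupBaseChange_eq_two_iff_isField`**.
-/

noncomputable section

open scoped TensorProduct

namespace Literature.AlgebraicGeometry.Motives

namespace HodgeStructure

universe u uK

variable (K : Type uK) [Field K] [Algebra ℚ K] {V : Type u} [AddCommGroup V] [Module ℚ V] [Module.Finite ℚ V] {n : ℤ}
  {H : HodgeStructure V n}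

/-! ## §0 Algebra: a reduced Artinian commutative ring has exactly one maximal ideal iff it is a field -/

omit [Algebra ℚ K] [Module.Finite ℚ V] in
/-- **A REDUCED COMMUTATIVE ARTINIAN RING WITH EXACTLY ONE MAXIMAL IDEAL IS A FIELD, AND CONVERSELY** (`Z ≅ Π_𝔪 Z/𝔪` with one
factor; Mathlib's `IsArtinianRing.isField_of_isReduced_of_isLocalRing`). [folklore] -/
private theorem natCard_maximalSpectrum_eq_one_iff_isField₅₅₁₁ (Z : Type*) [CommRing Z] [IsArtinianRing Z] [IsReduced Z] :
    Nat.card (MaximalSpectrum Z) = 1 ↔ IsField Z := by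
  rw [Nat.card_eq_one_iff_unique]
  constructor
  · rintro ⟨hsub, ⟨M⟩⟩
    haveI : IsLocalRing Z := IsLocalRing.of_unique_max_ideal
      ⟨M.asIdeal, M.isMaximal, fun I hI => congrArg MaximalSpectrum.asIdeal (Subsingleton.elim (⟨I, hI⟩ : MaximalSpectrum Z) M)⟩
    exact IsArtinianRing.isField_of_isReduced_of_isLocalRing Z
  · intro hF
    letI := hF.toField
    have hbot : ∀ M : MaximalSpectrum Z, M.asIdeal = ⊥ := fun M =>
      (Ideal.eq_bot_or_top M.asIdeal).resolve_right M.isMaximal.ne_top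
    exact ⟨⟨fun M M' => MaximalSpectrum.ext ((hbot M).trans (hbot M').symm)⟩, ⟨⟨⊥, Ideal.bot_isMaximal⟩⟩⟩

set_option maxSynthPendingDepth 4 in
/-- The standing instances on `Z_K(H)`: a finite-dimensional, hence Artinian, commutative `K`-algebra. [folklore] -/
private theorem isArtinianRing_center_centralizer₅₅₁₁ :
    IsArtinianRing (Subalgebra.center K (Subalgebra.centralizer K
      ((fun a : Module.End ℚ V => a.baseChange K) '' (H.endAlg : Set (Module.End ℚ V))))) := by
  haveI := finite_centralizer_endAlg_baseChange K H
  haveI : IsNoetherian K (Subalgebra.centralizer K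
      ((fun a : Module.End ℚ V => a.baseChange K) '' (H.endAlg : Set (Module.End ℚ V)))) :=
    isNoetherian_of_isNoetherianRing_of_finite K _
  haveI : Module.Finite K (Subalgebra.center K (Subalgebra.centralizer K
      ((fun a : Module.End ℚ V => a.baseChange K) '' (H.endAlg : Set (Module.End ℚ V))))) :=
    Module.Finite.of_injective (Subalgebra.val _).toLinearMap Subtype.val_injective
  exact IsArtinianRing.of_finite K _

/-! ## §1 `t_K(H) = 1` iff `Z(C(H)(K))` is a field -/

set_option maxSynthPendingDepth 4 in
/-- **`t_K = 1` IFF `Z(C(H)(K)) = C₀ ⊗ K` IS A FIELD** (polarizable `H`): `Z(C(H)(K))` is reduced (g55-#8) and finite-dimensional,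
and a reduced commutative Artinian ring with a single maximal ideal is a field.  For an isotypic `H` (`E_φ` simple, `C₀` a
field) this says: `C₀ ⊗ K` does not split iff it is a field. [cite: Milne1999LefschetzClasses, §1 p. 645 L1–L6 and Remark 1.6 (p. 644)] -/
theorem natCard_maximalSpectrum_center_centralizer_eq_one_iff_isField (hH : H.IsPolarizable) :
    Nat.card (MaximalSpectrum (Subalgebra.center K (Subalgebra.centralizer K
        ((fun a : Module.End ℚ V => a.baseChange K) '' (H.endAlg : Set (Module.End ℚ V)))))) = 1 ↔
      IsField (Subalgebra.center K (Subalgebra.centralizer K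
        ((fun a : Module.End ℚ V => a.baseChange K) '' (H.endAlg : Set (Module.End ℚ V))))) := by
  haveI := isArtinianRing_center_centralizer₅₅₁₁ K (H := H)
  haveI := isReduced_center_centralizer_endAlg_baseChange K hH
  exact natCard_maximalSpectrum_eq_one_iff_isField₅₅₁₁ _

/-! ## §2 `t_K(H) = t` iff no block centre splits -/

open Classical in
set_option maxSynthPendingDepth 4 in
/-- **`t_K(H) = t` IFF EVERY BLOCK CENTRE `Z(C(S)(K)) = C₀(S) ⊗ K` IS A FIELD** (every polarized `H`, every field `K ⊇ ℚ`):
`t_K(H) = Σ_S t_K(S)` with every `t_K(S) ≥ 1` (g55-#10), and `t_K(S) = 1` iff `Z(C(S)(K))` is a field (§1) — the centre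
`C₀ ⊗ K` has as many simple factors as `C₀` iff none of the fields `C₀(S)` splits over `K`.
[cite: Milne1999LefschetzClasses, §1 Prop. 1.5, Remark 1.6 (p. 644) and p. 645 L1–L14] [cite: Lange2023AbelianVarietiesComplex, §2.4.4 Cor. 2.4.26] -/
theorem Polarization.natCard_maximalSpectrum_center_centralizer_eq_card_iff_forall_isField (ψ : Polarization H) :
    Nat.card (MaximalSpectrum (Subalgebra.center K (Subalgebra.centralizer K
        ((fun a : Module.End ℚ V => a.baseChange K) '' (H.endAlg : Set (Module.End ℚ V)))))) =
      ψ.finite_setOf_minimal_stable.toFinset.card ↔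
      ∀ S : SubHodgeStructure H, ((∀ a ∈ H.endAlg, ∀ v ∈ S.toSubmodule, a v ∈ S.toSubmodule) ∧ S.toSubmodule ≠ ⊥ ∧
        ∀ S' : SubHodgeStructure H, (∀ a ∈ H.endAlg, ∀ v ∈ S'.toSubmodule, a v ∈ S'.toSubmodule) →
          S'.toSubmodule ≤ S.toSubmodule → S'.toSubmodule = ⊥ ∨ S'.toSubmodule = S.toSubmodule) →
        IsField (Subalgebra.center K (Subalgebra.centralizer K
          ((fun a : Module.End ℚ S.toSubmodule => a.baseChange K) ''
            (S.toHodgeStructure.endAlg : Set (Module.End ℚ S.toSubmodule))))) := by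
  rw [ψ.natCard_maximalSpectrum_center_centralizer_eq_sum_minimal_stable K, Finset.card_eq_sum_ones, eq_comm,
    Finset.sum_eq_sum_iff_of_le fun S hS =>
      one_le_natCard_maximalSpectrum_center_centralizer_of_ne_bot K ((Set.Finite.mem_toFinset _).1 hS).2.1]
  refine forall_congr' fun S => ?_
  rw [Set.Finite.mem_toFinset]
  refine ⟨fun h hS => ?_, fun h hS => ?_⟩
  · exact (natCard_maximalSpectrum_center_centralizer_eq_one_iff_isField K (H := S.toHodgeStructure) ⟨ψ.restrict S⟩).1
      (h hS).symm
  · exact ((natCard_maximalSpectrum_center_centralizer_eq_one_iff_isField K (H := S.toHodgeStructure) ⟨ψ.restrict S⟩).2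
      (h hS)).symm

open Classical in
set_option maxSynthPendingDepth 4 in
/-- **`t < t_K(H)` IFF SOME BLOCK CENTRE SPLITS OVER `K`** (is not a field after `⊗ K`). [cite: Milne1999LefschetzClasses, §1 Prop. 1.5, Remark 1.6 (p. 644) and p. 645 L1–L14] -/
theorem Polarization.card_toFinset_minimal_stable_lt_natCard_maximalSpectrum_iff (ψ : Polarization H) :
    ψ.finite_setOf_minimal_stable.toFinset.card <
      Nat.card (MaximalSpectrum (Subalgebra.center K (Subalgebra.centralizer K
        ((fun a : Module.End ℚ V => a.baseChange K) '' (H.endAlg : Set (Module.End ℚ V)))))) ↔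
      ∃ S : SubHodgeStructure H, ((∀ a ∈ H.endAlg, ∀ v ∈ S.toSubmodule, a v ∈ S.toSubmodule) ∧ S.toSubmodule ≠ ⊥ ∧
        ∀ S' : SubHodgeStructure H, (∀ a ∈ H.endAlg, ∀ v ∈ S'.toSubmodule, a v ∈ S'.toSubmodule) →
          S'.toSubmodule ≤ S.toSubmodule → S'.toSubmodule = ⊥ ∨ S'.toSubmodule = S.toSubmodule) ∧
        ¬ IsField (Subalgebra.center K (Subalgebra.centralizer K
          ((fun a : Module.End ℚ S.toSubmodule => a.baseChange K) ''
            (S.toHodgeStructure.endAlg : Set (Module.End ℚ S.toSubmodule))))) := by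
  rw [(ψ.card_toFinset_minimal_stable_le_natCard_maximalSpectrum K).lt_iff_ne, Ne, eq_comm,
    ψ.natCard_maximalSpectrum_center_centralizer_eq_card_iff_forall_isField K]
  push Not
  exact Iff.rfl

/-! ## §3 First kind: `#Z(S(H)(K)) = 2^t = #Z(S(H)(ℚ))` iff no block centre splits -/

open Classical in
set_option maxSynthPendingDepth 4 in
/-- **FIRST KIND: `#Z(S(A)(K)) = 2^t` IFF NO BLOCK CENTRE SPLITS OVER `K`** (`#Z(S(H)(K)) = 2^{t_K}`, g55-#8, and §2): the centre
`S₀(K) = Π_S μ₂(C₀(S) ⊗ K)` has exactly `2^t` elements iff each `C₀(S) ⊗ K` is still a field.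
[cite: Milne1999LefschetzClasses, §1 Prop. 1.5, Remark 1.6 (p. 644), p. 645 L1–L14 (S₀, Prop. 1.7) and §2 Summary p. 652]
[cite: MoonenZarhin1998WeilClasses, §1 Lemma (1)] -/
theorem Polarization.natCard_center_lefschetzGroupBaseChange_eq_two_pow_card_iff (ψ : Polarization H)
    (hfix : ∀ z : H.endAlg, z ∈ Subalgebra.center ℚ H.endAlg → ψ.adjoint (z : Module.End ℚ V) = z) :
    Nat.card (Subgroup.center (ψ.lefschetzGroupBaseChange K)) = 2 ^ ψ.finite_setOf_minimal_stable.toFinset.card ↔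
      ∀ S : SubHodgeStructure H, ((∀ a ∈ H.endAlg, ∀ v ∈ S.toSubmodule, a v ∈ S.toSubmodule) ∧ S.toSubmodule ≠ ⊥ ∧
        ∀ S' : SubHodgeStructure H, (∀ a ∈ H.endAlg, ∀ v ∈ S'.toSubmodule, a v ∈ S'.toSubmodule) →
          S'.toSubmodule ≤ S.toSubmodule → S'.toSubmodule = ⊥ ∨ S'.toSubmodule = S.toSubmodule) →
        IsField (Subalgebra.center K (Subalgebra.centralizer K
          ((fun a : Module.End ℚ S.toSubmodule => a.baseChange K) ''
            (S.toHodgeStructure.endAlg : Set (Module.End ℚ S.toSubmodule))))) := by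
  rw [ψ.natCard_center_lefschetzGroupBaseChange_eq_two_pow K hfix, (Nat.pow_right_injective le_rfl).eq_iff,
    ψ.natCard_maximalSpectrum_center_centralizer_eq_card_iff_forall_isField K]

open Classical in
/-- **`t = #{canonical blocks}`**: the `Nat.card` of the subtype of canonical blocks is the cardinality of the finite set of
them. [folklore] -/
private theorem Polarization.natCard_minimal_stable_eq_card_toFinset₅₅₁₁ (ψ : Polarization H) :
    Nat.card {S : SubHodgeStructure H // (∀ a ∈ H.endAlg, ∀ v ∈ S.toSubmodule, a v ∈ S.toSubmodule) ∧ S.toSubmodule ≠ ⊥ ∧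
        ∀ S' : SubHodgeStructure H, (∀ a ∈ H.endAlg, ∀ v ∈ S'.toSubmodule, a v ∈ S'.toSubmodule) →
          S'.toSubmodule ≤ S.toSubmodule → S'.toSubmodule = ⊥ ∨ S'.toSubmodule = S.toSubmodule} =
      ψ.finite_setOf_minimal_stable.toFinset.card := by
  haveI : Fintype {S : SubHodgeStructure H // (∀ a ∈ H.endAlg, ∀ v ∈ S.toSubmodule, a v ∈ S.toSubmodule) ∧ S.toSubmodule ≠ ⊥ ∧
      ∀ S' : SubHodgeStructure H, (∀ a ∈ H.endAlg, ∀ v ∈ S'.toSubmodule, a v ∈ S'.toSubmodule) →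
        S'.toSubmodule ≤ S.toSubmodule → S'.toSubmodule = ⊥ ∨ S'.toSubmodule = S.toSubmodule} :=
    ψ.finite_setOf_minimal_stable.fintype
  rw [Nat.card_eq_fintype_card, Fintype.card_eq_sum_ones, Finset.card_eq_sum_ones,
    ← Finset.sum_subtype ψ.finite_setOf_minimal_stable.toFinset (fun S => by rw [Set.Finite.mem_toFinset]; rfl) (fun _ => 1)]

open Classical in
set_option maxSynthPendingDepth 4 in
/-- **FIRST KIND: `#Z(S(A)(K)) = #Z(S(A)(ℚ))` IFF NO BLOCK CENTRE SPLITS OVER `K`** — the embedding `Z(S(H)(ℚ)) ↪ Z(S(H)(K))`,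
`γ ↦ γ_K` (g54-#10), is onto exactly when `K` is "disjoint" from every `C₀(S)`; `#Z(S(H)(ℚ)) = 2^t` is g54-#8.
[cite: Milne1999LefschetzClasses, §1 Prop. 1.5, Remark 1.6 (p. 644), p. 645 L1–L14 (S₀, Prop. 1.7) and §2 Summary p. 652]
[cite: MoonenZarhin1998WeilClasses, §1 Lemma (1)] [cite: Lange2023AbelianVarietiesComplex, §2.6.2 Lemma 2.6.4] -/
theorem Polarization.natCard_center_lefschetzGroupBaseChange_eq_natCard_center_lefschetzGroup_iff (ψ : Polarization H)
    (hfix : ∀ z : H.endAlg, z ∈ Subalgebra.center ℚ H.endAlg → ψ.adjoint (z : Module.End ℚ V) = z) :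
    Nat.card (Subgroup.center (ψ.lefschetzGroupBaseChange K)) = Nat.card (Subgroup.center ψ.lefschetzGroup) ↔
      ∀ S : SubHodgeStructure H, ((∀ a ∈ H.endAlg, ∀ v ∈ S.toSubmodule, a v ∈ S.toSubmodule) ∧ S.toSubmodule ≠ ⊥ ∧
        ∀ S' : SubHodgeStructure H, (∀ a ∈ H.endAlg, ∀ v ∈ S'.toSubmodule, a v ∈ S'.toSubmodule) →
          S'.toSubmodule ≤ S.toSubmodule → S'.toSubmodule = ⊥ ∨ S'.toSubmodule = S.toSubmodule) →
        IsField (Subalgebra.center K (Subalgebra.centralizer K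
          ((fun a : Module.End ℚ S.toSubmodule => a.baseChange K) ''
            (S.toHodgeStructure.endAlg : Set (Module.End ℚ S.toSubmodule))))) := by
  rw [ψ.natCard_center_lefschetzGroup_eq_two_pow hfix, ψ.natCard_minimal_stable_eq_card_toFinset₅₅₁₁,
    ψ.natCard_center_lefschetzGroupBaseChange_eq_two_pow_card_iff K hfix]

/-! ## §4 `E_φ` simple, first kind: `#Z(S(H)(K)) = 2` iff `C₀ ⊗ K` is a field -/

set_option maxSynthPendingDepth 4 in
/-- **`E_φ` SIMPLE, FIRST KIND: `#Z(S(A)(K)) = 2` IFF `Z(C(H)(K)) = C₀ ⊗ K` IS A FIELD** — then `Z(S(H)(K)) = {±1}` exactly as over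
`ℚ` (g55-#3 `#Z(S(H)(ℚ)) = 2`); otherwise `C₀ ⊗ K` splits into `t_K ≥ 2` fields and `#Z(S(H)(K)) = 2^{t_K} ≥ 4`.
[cite: Milne1999LefschetzClasses, §1 p. 645 L1–L14 (S₀, Prop. 1.7), Remark 1.6 (p. 644) and §2 Summary p. 652] [cite: MoonenZarhin1998WeilClasses, §1 Lemma (1)] -/
theorem Polarization.natCard_center_lefschetzGroupBaseChange_eq_two_iff_isField (ψ : Polarization H)
    (hfix : ∀ z : H.endAlg, z ∈ Subalgebra.center ℚ H.endAlg → ψ.adjoint (z : Module.End ℚ V) = z) :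
    Nat.card (Subgroup.center (ψ.lefschetzGroupBaseChange K)) = 2 ↔
      IsField (Subalgebra.center K (Subalgebra.centralizer K
        ((fun a : Module.End ℚ V => a.baseChange K) '' (H.endAlg : Set (Module.End ℚ V))))) := by
  rw [ψ.natCard_center_lefschetzGroupBaseChange_eq_two_pow K hfix, ← natCard_maximalSpectrum_center_centralizer_eq_one_iff_isField K ⟨ψ⟩]
  conv_lhs => rw [← pow_one 2]
  exact (Nat.pow_right_injective le_rfl).eq_iff

end HodgeStructure

end Literature.AlgebraicGeometry.Motives
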